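import Summits.Ventures.PercRepro.RankLevelSetRuleQCellFiveFalse
import Summits.Ventures.PercRepro.RankLevelSetRuleQCellFourRow

/-!
# PercRepro — THE BORDERLINE SLICE `u = 3` OF THE CELL `(q+5, q)`, PART I: THE SLICE SUMS IN CLOSED FORM
(night-1, gen 17; dossier §28)

The module RankLevelSetRuleQCellFiveSliceThree proves `Φ(q+5, q) ≤ R̂(q, 5, q−3)` for every `q ≥ 3` — Rule Q's equal split
pays the borderline slice `u = q − #P = 3` of every cell `(q+5, q)` (the slice `u = 2` fails from `q = 672`, `not_rhatCell_five`).
This part holds the combinatorial half, all at `q = s + 4`, `m = s + 1`: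
* `sum_range_choose_half_three` — the ODD half row `Σ_{i<s+1} C(2s+5, i) + C(2s+5, s+1) + C(2s+5, s+2) = 4^{s+2}`
  (`Nat.sum_range_choose_halfway`); `sum_range_choose_succ_row` — the row step `P(n+1, m) = 2P(n, m) − C(n, m−1)`;
* `slice_sum_step` — `S_{j+1}(q, m) = S_j(q, m) − (q/(q+1))·S_j(q+1, m)` for `S_j(q, m) = Σ_{a≤m} C(m, a)/C(q+j+a, a+j)`
  (the termwise identity `one_div_choose_succ_eq`);
* `rhat_five_slice_three_ge` — `R̂(m+3, 5, m) ≥ 8S₁ + 28S₂ + 56S₃ + 70S₄` (every `m̂ ≤ C(q+j+a, a+j)`, `mhat_le_choose`;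
  the truncated `j = 4` term is kept, not dropped);
* the rows `2s+5 … 2s+8` (`sliceThree_row0 … row3`) and the ratios between the binomials of those rows
  (`sliceThree_c01, cs0, C1, cs1, C2, cs2, C3, Cb`), the Wallis lower bound `3s + 7 ≤ x²` for
  `x = 4^{s+2}/C(2s+4, s+2)` (`sliceThree_wallis`, from `centralBinom_sq_mul_le`);
* **`sliceThree_S1_zero … three`** — the four sums `S₁(s+4+i, s+1)`, `i = 0 … 3`, in closed form `(A_i − B_i·x)/D_i`
  (polynomials in `s` with nonnegative coefficients; `slice_sum_one_eq` through the rows).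
Twin: mining/night-1/g17/k5u3_forms2.py (own exact rationals). Axioms: standard.
-/

namespace PercRepro

open Finset

/-! ### §1 The odd half row `2s + 5` and the row step -/

/-- **The half row, odd case**: `Σ_{i<s+1} C(2s+5, i) + C(2s+5, s+1) + C(2s+5, s+2) = 4^{s+2}`
(`Nat.sum_range_choose_halfway` at `s + 2`). -/
lemma sum_range_choose_half_three (s : ℕ) :
    ∑ i ∈ range (s + 1), (2 * s + 5).choose i + (2 * s + 5).choose (s + 1) + (2 * s + 5).choose (s + 2)
      = 4 ^ (s + 2) := by
  have h := Nat.sum_range_choose_halfway (s + 2)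
  rw [show 2 * (s + 2) + 1 = 2 * s + 5 by ring, Finset.sum_range_succ, Finset.sum_range_succ] at h
  exact h

/-- **The row step** in `ℚ`: `Σ_{i<s+1} C(n+1, i) = 2·Σ_{i<s+1} C(n, i) − C(n, s)` (Pascal, `sum_choose_succ_eq`). -/
lemma sum_range_choose_succ_row (n s : ℕ) :
    ∑ i ∈ range (s + 1), ((n + 1).choose i : ℚ)
      = 2 * ∑ i ∈ range (s + 1), (n.choose i : ℚ) - (n.choose s : ℚ) := by
  have h := sum_choose_succ_eq n s
  have h' : ((∑ i ∈ range (s + 1), (n + 1).choose i : ℕ) : ℚ)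
      = ((∑ i ∈ range (s + 1), n.choose i + ∑ i ∈ range s, n.choose i : ℕ) : ℚ) := by rw [h]
  push_cast at h'
  rw [h', Finset.sum_range_succ (fun i => (n.choose i : ℚ)) s]
  ring

/-! ### §2 The slice-sum step and the lower bound on `R̂(m+3, 5, m)` -/

/-- **The slice-sum step**: `S_{j+1}(q, m) = S_j(q, m) − (q/(q+1))·S_j(q+1, m)` for
`S_j(q, m) = Σ_{a≤m} C(m, a)/C(q+j+a, a+j)` (the termwise identity `one_div_choose_succ_eq` at `a + j`). -/
lemma slice_sum_step (q m j : ℕ) :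
    ∑ a ∈ range (m + 1), (m.choose a : ℚ) / ((q + (j + 1) + a).choose (a + (j + 1)) : ℚ)
      = ∑ a ∈ range (m + 1), (m.choose a : ℚ) / ((q + j + a).choose (a + j) : ℚ)
        - (q : ℚ) / ((q : ℚ) + 1)
          * ∑ a ∈ range (m + 1), (m.choose a : ℚ) / ((q + 1 + j + a).choose (a + j) : ℚ) := by
  rw [Finset.mul_sum, ← Finset.sum_sub_distrib]
  refine Finset.sum_congr rfl (fun a _ => ?_)
  have h := one_div_choose_succ_eq q (a + j)
  rw [show q + 1 + (a + j) = q + (j + 1) + a by ring, show a + j + 1 = a + (j + 1) by ring,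
    show q + (a + j) = q + j + a by ring] at h
  calc (m.choose a : ℚ) / ((q + (j + 1) + a).choose (a + (j + 1)) : ℚ)
      = (m.choose a : ℚ) * (1 / ((q + (j + 1) + a).choose (a + (j + 1)) : ℚ)) := by ring
    _ = (m.choose a : ℚ) * (1 / ((q + j + a).choose (a + j) : ℚ)
          - (q : ℚ) / ((q : ℚ) + 1) * (1 / ((q + (j + 1) + a).choose (a + j) : ℚ))) := by rw [h]
    _ = _ := by rw [show q + 1 + j + a = q + (j + 1) + a by ring]; ring

/-- **`R̂(m+3, 5, m) ≥ 8S₁ + 28S₂ + 56S₃ + 70S₄`** on the slice `u = 3` (`q = m + 3`, weights `C(8, j)`): every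
`m̂(q, m; a, j) ≤ C(q+j+a, a+j)` (`mhat_le_choose`; at `j = 4` the truncation only drops terms). -/
lemma rhat_five_slice_three_ge (m : ℕ) :
    8 * ∑ a ∈ range (m + 1), (m.choose a : ℚ) / ((m + 3 + 1 + a).choose (a + 1) : ℚ)
      + 28 * ∑ a ∈ range (m + 1), (m.choose a : ℚ) / ((m + 3 + 2 + a).choose (a + 2) : ℚ)
      + 56 * ∑ a ∈ range (m + 1), (m.choose a : ℚ) / ((m + 3 + 3 + a).choose (a + 3) : ℚ)
      + 70 * ∑ a ∈ range (m + 1), (m.choose a : ℚ) / ((m + 3 + 4 + a).choose (a + 4) : ℚ)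
      ≤ rhat (m + 3) 5 m := by
  unfold rhat
  rw [sum_Ioo_nat, show (5 : ℕ) - (0 + 1) = 1 + 1 + 1 + 1 from rfl, Finset.sum_range_succ _ (1 + 1 + 1),
    Finset.sum_range_succ _ (1 + 1), Finset.sum_range_succ _ 1, Finset.sum_range_one]
  simp only [zero_add, add_zero, Nat.reduceAdd, show m + 3 + 5 - m = 8 by omega, Nat.choose_one_right,
    show (8 : ℕ).choose 2 = 28 by decide, show (8 : ℕ).choose 3 = 56 by decide,
    show (8 : ℕ).choose 4 = 70 by decide]
  push_cast
  have key : ∀ (j a : ℕ) (w : ℚ), 0 ≤ w →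
      (m.choose a : ℚ) * w / ((m + 3 + j + a).choose (a + j) : ℚ)
        ≤ (m.choose a : ℚ) * w / (mhat (m + 3) m a j : ℚ) := by
    intro j a w hw
    apply div_le_div_of_nonneg_left (by positivity) (by exact_mod_cast mhat_pos _ _ _ _)
    exact_mod_cast mhat_le_choose (m + 3) m a j
  have s1 : 8 * ∑ a ∈ range (m + 1), (m.choose a : ℚ) / ((m + 3 + 1 + a).choose (a + 1) : ℚ)
      ≤ ∑ a ∈ range (m + 1), (m.choose a : ℚ) * 8 / (mhat (m + 3) m a 1 : ℚ) := by
    rw [Finset.mul_sum]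
    refine Finset.sum_le_sum (fun a _ => ?_)
    rw [show (8 : ℚ) * ((m.choose a : ℚ) / ((m + 3 + 1 + a).choose (a + 1) : ℚ))
      = (m.choose a : ℚ) * 8 / ((m + 3 + 1 + a).choose (a + 1) : ℚ) by ring]
    exact key 1 a _ (by positivity)
  have s2 : 28 * ∑ a ∈ range (m + 1), (m.choose a : ℚ) / ((m + 3 + 2 + a).choose (a + 2) : ℚ)
      ≤ ∑ a ∈ range (m + 1), (m.choose a : ℚ) * 28 / (mhat (m + 3) m a 2 : ℚ) := by
    rw [Finset.mul_sum]
    refine Finset.sum_le_sum (fun a _ => ?_)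
    rw [show (28 : ℚ) * ((m.choose a : ℚ) / ((m + 3 + 2 + a).choose (a + 2) : ℚ))
      = (m.choose a : ℚ) * 28 / ((m + 3 + 2 + a).choose (a + 2) : ℚ) by ring]
    exact key 2 a _ (by positivity)
  have s3 : 56 * ∑ a ∈ range (m + 1), (m.choose a : ℚ) / ((m + 3 + 3 + a).choose (a + 3) : ℚ)
      ≤ ∑ a ∈ range (m + 1), (m.choose a : ℚ) * 56 / (mhat (m + 3) m a 3 : ℚ) := by
    rw [Finset.mul_sum]
    refine Finset.sum_le_sum (fun a _ => ?_)
    rw [show (56 : ℚ) * ((m.choose a : ℚ) / ((m + 3 + 3 + a).choose (a + 3) : ℚ))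
      = (m.choose a : ℚ) * 56 / ((m + 3 + 3 + a).choose (a + 3) : ℚ) by ring]
    exact key 3 a _ (by positivity)
  have s4 : 70 * ∑ a ∈ range (m + 1), (m.choose a : ℚ) / ((m + 3 + 4 + a).choose (a + 4) : ℚ)
      ≤ ∑ a ∈ range (m + 1), (m.choose a : ℚ) * 70 / (mhat (m + 3) m a 4 : ℚ) := by
    rw [Finset.mul_sum]
    refine Finset.sum_le_sum (fun a _ => ?_)
    rw [show (70 : ℚ) * ((m.choose a : ℚ) / ((m + 3 + 4 + a).choose (a + 4) : ℚ))
      = (m.choose a : ℚ) * 70 / ((m + 3 + 4 + a).choose (a + 4) : ℚ) by ring]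
    exact key 4 a _ (by positivity)
  linarith [s1, s2, s3, s4]

/-! ### §4 The rows `2s+5 … 2s+8` and the ratios, as values -/

/-- The row `2s+5`: `P₀ = Σ_{i<s+1} C(2s+5, i) = 4^{s+2} − C(2s+5, s+1) − C(2s+5, s+2)`. -/
lemma sliceThree_row0 (s : ℕ) :
    ∑ i ∈ range (s + 1), ((2 * s + 5).choose i : ℚ)
      = (4 : ℚ) ^ (s + 2) - ((2 * s + 5).choose (s + 1) : ℚ) - ((2 * s + 5).choose (s + 2) : ℚ) := by
  have h := sum_range_choose_half_three s
  have h' : ((∑ i ∈ range (s + 1), (2 * s + 5).choose i + (2 * s + 5).choose (s + 1)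
      + (2 * s + 5).choose (s + 2) : ℕ) : ℚ) = ((4 ^ (s + 2) : ℕ) : ℚ) := by rw [h]
  push_cast at h'
  linarith [h']

/-- The row `2s+6` from the row `2s+5`: `P₁ = 2P₀ − C(2s+5, s)`. -/
lemma sliceThree_row1 (s : ℕ) :
    ∑ i ∈ range (s + 1), ((2 * s + 6).choose i : ℚ)
      = 2 * ∑ i ∈ range (s + 1), ((2 * s + 5).choose i : ℚ) - ((2 * s + 5).choose s : ℚ) := by
  have h := sum_range_choose_succ_row (2 * s + 5) s
  rw [show 2 * s + 5 + 1 = 2 * s + 6 by ring] at h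
  exact h

/-- The row `2s+7` from the row `2s+6`: `P₂ = 2P₁ − C(2s+6, s)`. -/
lemma sliceThree_row2 (s : ℕ) :
    ∑ i ∈ range (s + 1), ((2 * s + 7).choose i : ℚ)
      = 2 * ∑ i ∈ range (s + 1), ((2 * s + 6).choose i : ℚ) - ((2 * s + 6).choose s : ℚ) := by
  have h := sum_range_choose_succ_row (2 * s + 6) s
  rw [show 2 * s + 6 + 1 = 2 * s + 7 by ring] at h
  exact h

/-- The row `2s+8` from the row `2s+7`: `P₃ = 2P₂ − C(2s+7, s)`. -/
lemma sliceThree_row3 (s : ℕ) :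
    ∑ i ∈ range (s + 1), ((2 * s + 8).choose i : ℚ)
      = 2 * ∑ i ∈ range (s + 1), ((2 * s + 7).choose i : ℚ) - ((2 * s + 7).choose s : ℚ) := by
  have h := sum_range_choose_succ_row (2 * s + 7) s
  rw [show 2 * s + 7 + 1 = 2 * s + 8 by ring] at h
  exact h

/-- `C(2s+5, s+2) = C(2s+5, s+1)·(s+4)/(s+2)`. -/
lemma sliceThree_c01 (s : ℕ) :
    ((2 * s + 5).choose (s + 2) : ℚ) = ((2 * s + 5).choose (s + 1) : ℚ) * ((s : ℚ) + 4) / ((s : ℚ) + 2) := by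
  have h := Nat.choose_succ_right_eq (2 * s + 5) (s + 1)
  rw [show s + 1 + 1 = s + 2 by ring, show 2 * s + 5 - (s + 1) = s + 4 by omega] at h
  rw [eq_div_iff (by positivity)]
  exact_mod_cast h

/-- `C(2s+5, s) = C(2s+5, s+1)·(s+1)/(s+5)`. -/
lemma sliceThree_cs0 (s : ℕ) :
    ((2 * s + 5).choose s : ℚ) = ((2 * s + 5).choose (s + 1) : ℚ) * ((s : ℚ) + 1) / ((s : ℚ) + 5) := by
  have h := Nat.choose_succ_right_eq (2 * s + 5) s
  rw [show 2 * s + 5 - s = s + 5 by omega] at h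
  rw [eq_div_iff (by positivity)]
  have h' : ((2 * s + 5).choose (s + 1) : ℚ) * ((s : ℚ) + 1) = ((2 * s + 5).choose s : ℚ) * ((s : ℚ) + 5) := by
    exact_mod_cast h
  linarith [h']

/-- `C(2s+6, s+1) = C(2s+5, s+1)·(2s+6)/(s+5)`. -/
lemma sliceThree_C1 (s : ℕ) :
    ((2 * s + 6).choose (s + 1) : ℚ) = ((2 * s + 5).choose (s + 1) : ℚ) * (2 * (s : ℚ) + 6) / ((s : ℚ) + 5) := by
  have h := Nat.choose_mul_succ_eq (2 * s + 5) (s + 1)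
  rw [show 2 * s + 5 + 1 = 2 * s + 6 by ring, show 2 * s + 6 - (s + 1) = s + 5 by omega] at h
  rw [eq_div_iff (by positivity)]
  have h' : ((2 * s + 5).choose (s + 1) : ℚ) * (2 * (s : ℚ) + 6) = ((2 * s + 6).choose (s + 1) : ℚ) * ((s : ℚ) + 5) := by
    exact_mod_cast h
  linarith [h']

/-- `C(2s+6, s) = C(2s+5, s)·(2s+6)/(s+6)`. -/
lemma sliceThree_cs1 (s : ℕ) :
    ((2 * s + 6).choose s : ℚ) = ((2 * s + 5).choose s : ℚ) * (2 * (s : ℚ) + 6) / ((s : ℚ) + 6) := by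
  have h := Nat.choose_mul_succ_eq (2 * s + 5) s
  rw [show 2 * s + 5 + 1 = 2 * s + 6 by ring, show 2 * s + 6 - s = s + 6 by omega] at h
  rw [eq_div_iff (by positivity)]
  have h' : ((2 * s + 5).choose s : ℚ) * (2 * (s : ℚ) + 6) = ((2 * s + 6).choose s : ℚ) * ((s : ℚ) + 6) := by
    exact_mod_cast h
  linarith [h']

/-- `C(2s+7, s+1) = C(2s+6, s+1)·(2s+7)/(s+6)`. -/
lemma sliceThree_C2 (s : ℕ) :
    ((2 * s + 7).choose (s + 1) : ℚ) = ((2 * s + 6).choose (s + 1) : ℚ) * (2 * (s : ℚ) + 7) / ((s : ℚ) + 6) := by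
  have h := Nat.choose_mul_succ_eq (2 * s + 6) (s + 1)
  rw [show 2 * s + 6 + 1 = 2 * s + 7 by ring, show 2 * s + 7 - (s + 1) = s + 6 by omega] at h
  rw [eq_div_iff (by positivity)]
  have h' : ((2 * s + 6).choose (s + 1) : ℚ) * (2 * (s : ℚ) + 7) = ((2 * s + 7).choose (s + 1) : ℚ) * ((s : ℚ) + 6) := by
    exact_mod_cast h
  linarith [h']

/-- `C(2s+7, s) = C(2s+6, s)·(2s+7)/(s+7)`. -/
lemma sliceThree_cs2 (s : ℕ) :
    ((2 * s + 7).choose s : ℚ) = ((2 * s + 6).choose s : ℚ) * (2 * (s : ℚ) + 7) / ((s : ℚ) + 7) := by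
  have h := Nat.choose_mul_succ_eq (2 * s + 6) s
  rw [show 2 * s + 6 + 1 = 2 * s + 7 by ring, show 2 * s + 7 - s = s + 7 by omega] at h
  rw [eq_div_iff (by positivity)]
  have h' : ((2 * s + 6).choose s : ℚ) * (2 * (s : ℚ) + 7) = ((2 * s + 7).choose s : ℚ) * ((s : ℚ) + 7) := by
    exact_mod_cast h
  linarith [h']

/-- `C(2s+8, s+1) = C(2s+7, s+1)·(2s+8)/(s+7)`. -/
lemma sliceThree_C3 (s : ℕ) :
    ((2 * s + 8).choose (s + 1) : ℚ) = ((2 * s + 7).choose (s + 1) : ℚ) * (2 * (s : ℚ) + 8) / ((s : ℚ) + 7) := by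
  have h := Nat.choose_mul_succ_eq (2 * s + 7) (s + 1)
  rw [show 2 * s + 7 + 1 = 2 * s + 8 by ring, show 2 * s + 8 - (s + 1) = s + 7 by omega] at h
  rw [eq_div_iff (by positivity)]
  have h' : ((2 * s + 7).choose (s + 1) : ℚ) * (2 * (s : ℚ) + 8) = ((2 * s + 8).choose (s + 1) : ℚ) * ((s : ℚ) + 7) := by
    exact_mod_cast h
  linarith [h']

/-- The central binomial against the row `2s+5`: `C(2s+4, s+2) = C(2s+5, s+2)·(s+3)/(2s+5)`. -/
lemma sliceThree_Cb (s : ℕ) :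
    ((2 * s + 4).choose (s + 2) : ℚ) = ((2 * s + 5).choose (s + 2) : ℚ) * ((s : ℚ) + 3) / (2 * (s : ℚ) + 5) := by
  have h := Nat.choose_mul_succ_eq (2 * s + 4) (s + 2)
  rw [show 2 * s + 4 + 1 = 2 * s + 5 by ring, show 2 * s + 5 - (s + 2) = s + 3 by omega] at h
  rw [eq_div_iff (by positivity)]
  have h' : ((2 * s + 4).choose (s + 2) : ℚ) * (2 * (s : ℚ) + 5) = ((2 * s + 5).choose (s + 2) : ℚ) * ((s : ℚ) + 3) := by
    exact_mod_cast h
  exact h'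

/-- **Wallis at `k = s+2`**: `3s + 7 ≤ x²` for `x = 4^{s+2}/C(2s+4, s+2)` (`centralBinom_sq_mul_le`). -/
lemma sliceThree_wallis (s : ℕ) :
    3 * (s : ℚ) + 7 ≤ ((4 : ℚ) ^ (s + 2) / ((2 * s + 4).choose (s + 2) : ℚ)) ^ 2 := by
  have h := centralBinom_sq_mul_le (s + 2) (by omega)
  rw [Nat.centralBinom_eq_two_mul_choose, show 2 * (s + 2) = 2 * s + 4 by ring] at h
  have h' : (((2 * s + 4).choose (s + 2) ^ 2 * (3 * (s + 2) + 1) : ℕ) : ℚ) ≤ ((16 ^ (s + 2) : ℕ) : ℚ) := by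
    exact_mod_cast h
  push_cast at h'
  have hCb : (0 : ℚ) < ((2 * s + 4).choose (s + 2) : ℚ) := by exact_mod_cast Nat.choose_pos (by omega)
  rw [div_pow, le_div_iff₀ (by positivity)]
  have h16 : (16 : ℚ) ^ (s + 2) = ((4 : ℚ) ^ (s + 2)) ^ 2 := by
    rw [← pow_mul, mul_comm, pow_mul]; norm_num
  rw [← h16]
  linarith [h']

/-! ### §5 The four `S₁` sums in closed form, `x = 4^{s+2}/C(2s+4, s+2)` -/

/-- `S₁(s+4, s+1)` (the row `2s+5`) in closed form: `(80 + 72s + 21s² + 2s³ − (24 + 14s + 2s²)·x)/(60 + 74s + 30s² + 4s³)`. -/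
lemma sliceThree_S1_zero (s : ℕ) :
    ∑ a ∈ range (s + 1 + 1), ((s + 1).choose a : ℚ) / ((s + 1 + 3 + 1 + a).choose (a + 1) : ℚ)
      = (((80 : ℚ) + (72 : ℚ) * (s : ℚ) + (21 : ℚ) * (s : ℚ) ^ 2 + (2 : ℚ) * (s : ℚ) ^ 3)
          - ((24 : ℚ) + (14 : ℚ) * (s : ℚ) + (2 : ℚ) * (s : ℚ) ^ 2)
            * ((4 : ℚ) ^ (s + 2) / ((2 * s + 4).choose (s + 2) : ℚ)))
        / ((60 : ℚ) + (74 : ℚ) * (s : ℚ) + (30 : ℚ) * (s : ℚ) ^ 2 + (4 : ℚ) * (s : ℚ) ^ 3) := by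
  rw [slice_sum_one_eq (s + 1 + 3) (s + 1), show s + 1 + 3 + (s + 1) = 2 * s + 5 by ring]
  push_cast
  have hC : (0 : ℚ) < ((2 * s + 5).choose (s + 1) : ℚ) := by exact_mod_cast Nat.choose_pos (by omega)
  rw [sliceThree_row0, sliceThree_Cb, sliceThree_c01]
  field_simp
  ring

/-- `S₁(s+5, s+1)` (the row `2s+6`) in closed form. -/
lemma sliceThree_S1_one (s : ℕ) :
    ∑ a ∈ range (s + 1 + 1), ((s + 1).choose a : ℚ) / ((s + 1 + 3 + 1 + 1 + a).choose (a + 1) : ℚ)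
      = (((1050 : ℚ) + (1105 : ℚ) * (s : ℚ) + (419 : ℚ) * (s : ℚ) ^ 2 + (68 : ℚ) * (s : ℚ) ^ 3 + (4 : ℚ) * (s : ℚ) ^ 4)
          - ((360 : ℚ) + (282 : ℚ) * (s : ℚ) + (72 : ℚ) * (s : ℚ) ^ 2 + (6 : ℚ) * (s : ℚ) ^ 3)
            * ((4 : ℚ) ^ (s + 2) / ((2 * s + 4).choose (s + 2) : ℚ)))
        / ((420 : ℚ) + (638 : ℚ) * (s : ℚ) + (358 : ℚ) * (s : ℚ) ^ 2 + (88 : ℚ) * (s : ℚ) ^ 3 + (8 : ℚ) * (s : ℚ) ^ 4) := by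
  rw [slice_sum_one_eq (s + 1 + 3 + 1) (s + 1), show s + 1 + 3 + 1 + (s + 1) = 2 * s + 6 by ring]
  push_cast
  have hC : (0 : ℚ) < ((2 * s + 5).choose (s + 1) : ℚ) := by exact_mod_cast Nat.choose_pos (by omega)
  rw [sliceThree_row1, sliceThree_row0, sliceThree_C1, sliceThree_cs0, sliceThree_Cb, sliceThree_c01]
  field_simp
  ring

/-- `S₁(s+6, s+1)` (the row `2s+7`) in closed form. -/
lemma sliceThree_S1_two (s : ℕ) :
    ∑ a ∈ range (s + 1 + 1), ((s + 1).choose a : ℚ) / ((s + 1 + 3 + 1 + 1 + 1 + a).choose (a + 1) : ℚ)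
      = (((7980 : ℚ) + (9532 : ℚ) * (s : ℚ) + (4361 : ℚ) * (s : ℚ) ^ 2 + (955 : ℚ) * (s : ℚ) ^ 3 + (100 : ℚ) * (s : ℚ) ^ 4 + (4 : ℚ) * (s : ℚ) ^ 5)
          - ((2880 : ℚ) + (2736 : ℚ) * (s : ℚ) + (952 : ℚ) * (s : ℚ) ^ 2 + (144 : ℚ) * (s : ℚ) ^ 3 + (8 : ℚ) * (s : ℚ) ^ 4)
            * ((4 : ℚ) ^ (s + 2) / ((2 * s + 4).choose (s + 2) : ℚ)))
        / ((1680 : ℚ) + (2972 : ℚ) * (s : ℚ) + (2070 : ℚ) * (s : ℚ) ^ 2 + (710 : ℚ) * (s : ℚ) ^ 3 + (120 : ℚ) * (s : ℚ) ^ 4 + (8 : ℚ) * (s : ℚ) ^ 5) := by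
  rw [slice_sum_one_eq (s + 1 + 3 + 1 + 1) (s + 1), show s + 1 + 3 + 1 + 1 + (s + 1) = 2 * s + 7 by ring]
  push_cast
  have hC : (0 : ℚ) < ((2 * s + 5).choose (s + 1) : ℚ) := by exact_mod_cast Nat.choose_pos (by omega)
  rw [sliceThree_row2, sliceThree_row1, sliceThree_row0, sliceThree_C2, sliceThree_C1, sliceThree_cs1, sliceThree_cs0,
    sliceThree_Cb, sliceThree_c01]
  field_simp
  ring

/-- `S₁(s+7, s+1)` (the row `2s+8`) in closed form. -/
lemma sliceThree_S1_three (s : ℕ) :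
    ∑ a ∈ range (s + 1 + 1), ((s + 1).choose a : ℚ) / ((s + 1 + 3 + 1 + 1 + 1 + 1 + a).choose (a + 1) : ℚ)
      = (((136710 : ℚ) + (181139 : ℚ) * (s : ℚ) + (95782 : ℚ) * (s : ℚ) ^ 2 + (25855 : ℚ) * (s : ℚ) ^ 3 + (3750 : ℚ) * (s : ℚ) ^ 4 + (276 : ℚ) * (s : ℚ) ^ 5 + (8 : ℚ) * (s : ℚ) ^ 6)
          - ((50400 : ℚ) + (55080 : ℚ) * (s : ℚ) + (23500 : ℚ) * (s : ℚ) ^ 2 + (4900 : ℚ) * (s : ℚ) ^ 3 + (500 : ℚ) * (s : ℚ) ^ 4 + (20 : ℚ) * (s : ℚ) ^ 5)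
            * ((4 : ℚ) ^ (s + 2) / ((2 * s + 4).choose (s + 2) : ℚ)))
        / ((15120 : ℚ) + (30108 : ℚ) * (s : ℚ) + (24574 : ℚ) * (s : ℚ) ^ 2 + (10530 : ℚ) * (s : ℚ) ^ 3 + (2500 : ℚ) * (s : ℚ) ^ 4 + (312 : ℚ) * (s : ℚ) ^ 5 + (16 : ℚ) * (s : ℚ) ^ 6) := by
  rw [slice_sum_one_eq (s + 1 + 3 + 1 + 1 + 1) (s + 1), show s + 1 + 3 + 1 + 1 + 1 + (s + 1) = 2 * s + 8 by ring]
  push_cast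
  have hC : (0 : ℚ) < ((2 * s + 5).choose (s + 1) : ℚ) := by exact_mod_cast Nat.choose_pos (by omega)
  rw [sliceThree_row3, sliceThree_row2, sliceThree_row1, sliceThree_row0, sliceThree_C3, sliceThree_C2, sliceThree_C1,
    sliceThree_cs2, sliceThree_cs1, sliceThree_cs0, sliceThree_Cb, sliceThree_c01]
  field_simp
  ring

end PercRepro
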